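import Summits.Ventures.PercRepro.Conjectures
import Summits.Ventures.PercRepro.ClusterFreeze

/-!
# PercRepro — C-010: the per-type cluster-freeze inequality as a row (typer-2, gen 2)

p5's `MultiGraph.cluster_freeze_ineq` (ClusterFreeze.lean, proved by revealing the clusters of `s`
and `t` and Ahlswede–Daykin outside the frozen edges) filed by the lead as row C-010 (INBOX
2026-08-22T02:59:12Z, 03:01:22Z): T2 done first. `C010` is the statement as a named Prop in the
shape of the other rows (∀ finite multigraph, ∀ `p ∈ [0,1]^E`, ∀ six vertices), `C010_holds` its
proof. Events in connection atoms (`G.Conn ω u v`); the right side is the C-005 bracket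
`[a·b_R − r·c⁺]` of the cross term `M` for the pair `(s, t)`.
-/

namespace PercRepro

/-- **C-010** (p5's `cluster_freeze_ineq`, lead 02:59:12Z): for six vertices `s t m m' m'' m'''`,
`P(s~m, t~m', m''~m''', m≁m', m≁m'', m'≁m'') · P((m~m'' ∧ m'~m''' ∧ m≁m') ∨ (m~m''' ∧ m'~m'' ∧ m≁m'))
  ≤ P(m~m'~m''~m''') · P(s~m, t~m', all of m m' m'' m''' pairwise disconnected)`. -/
def C010 : Prop :=
  ∀ {V E : Type} [Fintype E] [DecidableEq E] (G : MultiGraph V E) (p : E → ℝ), IsProb p →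
    ∀ s t m m' m'' m''' : V,
      prob p {ω | G.Conn ω s m ∧ G.Conn ω t m' ∧ G.Conn ω m'' m''' ∧ ¬ G.Conn ω m m' ∧
          ¬ G.Conn ω m m'' ∧ ¬ G.Conn ω m' m''} *
        prob p ({ω | G.Conn ω m m'' ∧ G.Conn ω m' m''' ∧ ¬ G.Conn ω m m'} ∪
          {ω | G.Conn ω m m''' ∧ G.Conn ω m' m'' ∧ ¬ G.Conn ω m m'}) ≤
      prob p {ω | G.Conn ω m m' ∧ G.Conn ω m' m'' ∧ G.Conn ω m'' m'''} *
        prob p {ω | G.Conn ω s m ∧ G.Conn ω t m' ∧ ¬ G.Conn ω m m' ∧ ¬ G.Conn ω m m'' ∧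
          ¬ G.Conn ω m m''' ∧ ¬ G.Conn ω m' m'' ∧ ¬ G.Conn ω m' m''' ∧ ¬ G.Conn ω m'' m'''}

/-- **C-010 holds** (p5's `cluster_freeze_ineq`). -/
theorem C010_holds : C010 := fun G _ hp s t m m' m'' m''' => G.cluster_freeze_ineq hp s t m m' m'' m'''

end PercRepro
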